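import Summits.SmoothPoincare4.SmoothPoincare4.Theorems.SullivanDualHyperbolicEndTaubesModelDefs
import Summits.SmoothPoincare4.SmoothPoincare4.Theorems.SullivanDualHyperbolicEndTaubesModelIdentities
import Summits.SmoothPoincare4.SmoothPoincare4.Theorems.SullivanDualHyperbolicEndHelperTaubesCoframe

/-!
# Route `SullivanDual`, crux `HyperbolicEnd` (stmt-SmoothPoincare4-7825), line `taubes-circle-pencil`:
# the screw planes of Taubes' model are `J♭`-invariant

Registered helper `helper_taubesJ_screwPlane`.  In Taubes' untwisted model on `S¹ × B³`
(Geom. Topol. 2 (1998), §1, eq. (1.4)) write `a = taubesR y − 1`, `b = y₂`, `c = y₃`,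
`ρ² = a² + b²`, `ρ²dφ = a db − b da`, `H = c ρ²` (so `dH(u) = ρ² u₃ + 2c (a da(u) + b u₂)`),
`dQ = taubesDQ`, `dt = taubesDt`.  For a real parameter `k` the *screw plane* at `y` is the 2-plane
`V_k = ker(ρ²(dφ − k dt)) ∩ ker(dH − k ρ² dQ)`.  The statement: `V_k` is invariant under Taubes'
singular almost complex structure `J♭ = taubesJ` on the punctured tube.  For `k = 0` these are the
tangent planes of Taubes' model foliation F2 `{φ = const, h = const}` (loc. cit., Example 1.6); for
general `k` they are the tangent planes of the screw-modulated family `{φ = kt + c, h = H(f)}`,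
`H' = kρ²`, of `J♭`-holomorphic surfaces used in the local analysis of the crux.

Proof: immediate from the coframe identities `helper_taubesJ_coframe`
(`dt ∘ J♭ = −dQ/g`, `dQ ∘ J♭ = g dt`, `dH ∘ J♭ = g ρ²dφ`, `ρ²dφ ∘ J♭ = −dH/g`, `g = |∇Q| > 0`):
the two defining forms `θ₁ = ρ²(dφ − k dt)`, `θ₂ = dH − kρ² dQ` satisfy `θ₁ ∘ J♭ = −θ₂/g` and
`θ₂ ∘ J♭ = g θ₁`.
-/

-- the registered namespace `Summit.SmoothPoincare4.SmoothPoincare4.…` repeats a component (P = Sub)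
set_option linter.dupNamespace false

noncomputable section

namespace Summit.SmoothPoincare4.SmoothPoincare4.Cruxes.HyperbolicEnd.TaubesCirclePencil

/-- **Screw planes are `J♭`-invariant.**  On the punctured tube, for every `k : ℝ` the 2-plane
`ker(ρ²(dφ − k dt)) ∩ ker(dH − k ρ² dQ)` (with `ρ² = (r−1)² + y₂²`,
`(ρ²dφ)(u) = (r−1) u₂ − y₂ da(u)`, `dH(u) = ρ² u₃ + 2y₃((r−1) da(u) + y₂ u₂)`) is preserved by
Taubes' singular almost complex structure `J♭ = taubesJ`; for `k = 0` these are the tangent planes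
of Taubes' foliation F2 `{φ = const, h = const}`.
[cite: Taubes1998S1B3, §1 eq. (1.4) and Example 1.6] -/
theorem helper_taubesJ_screwPlane :
    ∀ (δ : ℝ) (y : EuclideanSpace ℝ (Fin 4)), 0 < δ → δ < 1 → y ∈ taubesTube δ → y ∉ taubesCore →
      ∀ (k : ℝ) (u : EuclideanSpace ℝ (Fin 4)),
        (taubesR y - 1) * u 2 - y 2 * taubesDa y u
            - k * ((taubesR y - 1) ^ 2 + y 2 ^ 2) * taubesDt y u = 0 →
        ((taubesR y - 1) ^ 2 + y 2 ^ 2) * u 3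
            + 2 * y 3 * ((taubesR y - 1) * taubesDa y u + y 2 * u 2)
            - k * ((taubesR y - 1) ^ 2 + y 2 ^ 2) * taubesDQ y u = 0 →
        (taubesR y - 1) * (taubesJ y u) 2 - y 2 * taubesDa y (taubesJ y u)
            - k * ((taubesR y - 1) ^ 2 + y 2 ^ 2) * taubesDt y (taubesJ y u) = 0 ∧
        ((taubesR y - 1) ^ 2 + y 2 ^ 2) * (taubesJ y u) 3
            + 2 * y 3 * ((taubesR y - 1) * taubesDa y (taubesJ y u) + y 2 * (taubesJ y u) 2)
            - k * ((taubesR y - 1) ^ 2 + y 2 ^ 2) * taubesDQ y (taubesJ y u) = 0 := by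
  intro δ y hδ0 hδ1 hy hc k u hθ1 hθ2
  have hg : taubesGrad y ≠ 0 := (helper_taubesGrad_pos δ y hδ0 hδ1 hy hc).ne'
  obtain ⟨h1, h2, h3, h4⟩ := helper_taubesJ_coframe δ y hδ0 hδ1 hy hc u
  constructor
  · rw [h4, h1]
    field_simp
    linear_combination (-1 : ℝ) * hθ2
  · rw [h3, h2]
    linear_combination (taubesGrad y) * hθ1

end Summit.SmoothPoincare4.SmoothPoincare4.Cruxes.HyperbolicEnd.TaubesCirclePencil

end
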